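import Summits.NavierStokesRegularity.TurbBounds.Certs.P2R4.EvalN12Data6
import Summits.NavierStokesRegularity.TurbBounds.CouplingSplit
import Summits.NavierStokesRegularity.TurbBounds.TailP2R4LadderFormsN12
import HarnessLib

/-!
# Row P2-R4 tail lemma (N12, dim 45) — structured quadratic forms of the literal rule pieces, part 6/6: TT
(cell `pub-turb` / `turb-bounds`; v2; GENERATED by HOME/pub-turb-cert/lean-tail-v2/tailgen/emit/emit_tail.py N12 P2R4 from the tree's `Certs/P2R4/EvalN12Data*.lean`
literals; each identity says 'this literal piece IS the Legendre–Galerkin object of rbsdp SPEC 3.3–3.6' (LEAN-MAP data item (a) for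
row P2-R4), kernel arithmetic only. The coupling pieces `CE_p` are identified with `2·couplingMode 12 8 p` at the ladder coefficients.)

HONEST FRAMING: rigorous bounds for the stated PDE and boundary conditions; no claim about physical turbulence beyond the bound.
-/

set_option linter.style.longLine false
set_option linter.style.setOption false
set_option maxRecDepth 100000

noncomputable section

namespace Summit.NavierStokesRegularity.TurbBounds.TailP2R4.N12

open Finset Matrix Literature.Computation.Certificates
open Summit.NavierStokesRegularity.TurbBounds.LadderTail (w phi lam)
open Summit.NavierStokesRegularity.TurbBounds.CouplingSplit (couplingMode)
open Summit.NavierStokesRegularity.TurbBounds.Certs.P2R4.Evaluator.N12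

set_option maxHeartbeats 20000000 in
/-- structured quadratic form of the literal piece `TT` (45×45, 26 nonzero entries) -/
theorem quadForm_TT (x : Fin 45 → ℝ) :
    x ⬝ᵥ (TT.map (Rat.cast : ℚ → ℝ) *ᵥ x) = (w 13 * eL x 13 ^ 2 + w 14 * eL x 14 ^ 2 + w 15 * eL x 15 ^ 2 + w 16 * eL x 16 ^ 2 + w 17 * eL x 17 ^ 2 + w 18 * eL x 18 ^ 2 + w 19 * eL x 19 ^ 2 + w 20 * eL x 20 ^ 2) + phi 20 * xd x 20 ^ 2 + phi 21 * xd x 21 ^ 2 := by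
  simp (maxSteps := 20000000) [dotProduct, mulVec, Fin.sum_univ_succ, TT, TT_rows, TT_rows_r0, TT_rows_r1, TT_rows_r2, TT_rows_r3, TT_rows_r4, TT_rows_r5, TT_rows_r6, TT_rows_r7, TT_rows_r8, TT_rows_r9, TT_rows_r10, TT_rows_r11, TT_rows_r12, TT_rows_r13, TT_rows_r14, TT_rows_r15, TT_rows_r16, TT_rows_r17, TT_rows_r18, TT_rows_r19, TT_rows_r20, TT_rows_r21, TT_rows_r22, TT_rows_r23, TT_rows_r24, TT_rows_r25, TT_rows_r26, TT_rows_r27, TT_rows_r28, TT_rows_r29, TT_rows_r30, TT_rows_r31, TT_rows_r32, TT_rows_r33, TT_rows_r34, TT_rows_r35, TT_rows_r36, TT_rows_r37, TT_rows_r38, TT_rows_r39, TT_rows_r40, TT_rows_r41, TT_rows_r42, TT_rows_r43, TT_rows_r44, List.getD,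
    eL, xd, w, phi]
  ring

end Summit.NavierStokesRegularity.TurbBounds.TailP2R4.N12

end
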